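import Mathlib
import Summits.NavierStokesRegularity.NavierStokesRegularity.Theorems.SubcriticalEnvelopeForwardSourceSmoothingShell
import HarnessLib

/-!
# `SubcriticalEnvelope.ForwardSourceSmoothing` (stmt-NavierStokesRegularity-26374, crux B⁺) — stage γ₁:
the non-source energies beyond the crossover shell (helper file, `--supports`)

With source amplitudes `|X_{s,k}| ≤ A(1+ε₀)^{-γk}` (`γ = (1+η)/2 ∈ [1/2, 1]`, from the subcritical
`S`-envelope) the dissipative per-shell bound of stage β
(`forwardSourceSmoothing_shell_dissipative`) reads, in the weighted variables
`V_k = (1+ε₀)^{2γk}·sup_t y_k(t)` and for shells `k ≥ n₁` beyond the `ν`-dependent crossover,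
`V_k ≤ E₁ + ½V_{k+1}` (`forwardSourceSmoothing_dissipative_constants`: the constants bookkeeping).
Since the regular solution's a priori weight `(1+ε₀)^{10k}` makes `V_k` bounded (by a
solution-dependent constant), iterating the recursion and letting the number of iterations tend to
infinity gives the SOLUTION-INDEPENDENT bound `V_k ≤ 2E₁`, i.e.
`Σ_{d∉S} ½X_{d,k}(t)² ≤ 2E₁(1+ε₀)^{-2γk}` for all `k ≥ n₁` (`forwardSourceSmoothing_far_shells`):
the non-source modes inherit the subcritical envelope of the sources beyond the crossover.

HONEST FRAMING: estimates for Tao-type MODEL lattice ODEs (Tao 2016 §4; BMR 2011 §3 type bootstrap);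
nothing here bears on the Navier–Stokes equations; no summit is proved.
-/

noncomputable section

-- the sub-problem namespace `NavierStokesRegularity.NavierStokesRegularity` is the tree's layout (D-0017)
set_option linter.dupNamespace false

namespace Summit.NavierStokesRegularity.NavierStokesRegularity.Theorems

open Set Finset
open Literature.Analysis.FluidPDE.TaoCascade

variable {m : ℕ}

/-! ## Constants bookkeeping for the dissipative recursion -/

/-- The polynomial core of the bookkeeping: with `c = L(4P(Au)² + 2P(Au)W + Q(A g u)²)`,
`Q ≤ P`, `W² = 2V'u²β`, `g² = G`, `P²u² = ρD`, `ρ ≤ 1` and `16L²A²βρ/ν² ≤ ½`: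
`c²/(ν²D) ≤ (2L²A⁴(4+G)²/ν² + V'/2)·u²`. [folklore] -/
theorem forwardSourceSmoothing_constants_core {L A ν P Q u W V' β g G ρ D : ℝ} (hL : 0 ≤ L)
    (hA : 0 ≤ A) (hν : 0 < ν) (hP : 0 ≤ P) (hQ : 0 ≤ Q) (hQP : Q ≤ P) (hu : 0 ≤ u) (hW : 0 ≤ W)
    (hV : 0 ≤ V') (hWsq : W ^ 2 = 2 * V' * (u ^ 2 * β)) (hg : g ^ 2 = G) (hG : 0 ≤ G)
    (hρ : 0 ≤ ρ) (hρ1 : ρ ≤ 1) (hD : 0 < D) (hPu : P ^ 2 * u ^ 2 = ρ * D)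
    (hθ : 16 * L ^ 2 * A ^ 2 * β / ν ^ 2 * ρ ≤ 1 / 2) :
    (L * (4 * P * (A * u) ^ 2 + 2 * P * (A * u) * W + Q * (A * g * u) ^ 2)) ^ 2 / (ν ^ 2 * D) ≤
      (2 * L ^ 2 * A ^ 4 * (4 + G) ^ 2 / ν ^ 2 + V' / 2) * u ^ 2 := by
  have hνD : 0 < ν ^ 2 * D := by positivity
  rw [div_le_iff₀ hνD]
  -- `0 ≤ c ≤ c' = L P u A ((4 + G) A u + 2 W)`
  have hc0 : 0 ≤ L * (4 * P * (A * u) ^ 2 + 2 * P * (A * u) * W + Q * (A * g * u) ^ 2) := by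
    positivity
  have hcc' : L * (4 * P * (A * u) ^ 2 + 2 * P * (A * u) * W + Q * (A * g * u) ^ 2) ≤
      L * (P * u * A * ((4 + G) * A * u + 2 * W)) := by
    refine mul_le_mul_of_nonneg_left ?_ hL
    have h1 : Q * (A * g * u) ^ 2 ≤ P * (A * g * u) ^ 2 := mul_le_mul_of_nonneg_right hQP (sq_nonneg _)
    have h2 : P * (A * g * u) ^ 2 = P * u * A * (G * A * u) := by rw [← hg]; ring
    nlinarith
  have hsq : (L * (4 * P * (A * u) ^ 2 + 2 * P * (A * u) * W + Q * (A * g * u) ^ 2)) ^ 2 ≤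
      (L * (P * u * A * ((4 + G) * A * u + 2 * W))) ^ 2 := pow_le_pow_left₀ hc0 hcc' 2
  -- `((4+G)Au + 2W)² ≤ 2(4+G)²A²u² + 8W²`
  have hAMGM : ((4 + G) * A * u + 2 * W) ^ 2 ≤ 2 * ((4 + G) * A * u) ^ 2 + 8 * W ^ 2 := by
    nlinarith [sq_nonneg ((4 + G) * A * u - 2 * W)]
  have hmain : (L * (P * u * A * ((4 + G) * A * u + 2 * W))) ^ 2 ≤
      L ^ 2 * A ^ 2 * (ρ * D) * (2 * ((4 + G) * A * u) ^ 2 + 8 * W ^ 2) := by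
    have : (L * (P * u * A * ((4 + G) * A * u + 2 * W))) ^ 2 =
        L ^ 2 * A ^ 2 * (P ^ 2 * u ^ 2) * ((4 + G) * A * u + 2 * W) ^ 2 := by ring
    rw [this, hPu]
    exact mul_le_mul_of_nonneg_left hAMGM (by positivity)
  -- evaluate with `W² = 2V'u²β` and use `ρ ≤ 1`, `16L²A²βρ/ν² ≤ 1/2`
  have hfinal : L ^ 2 * A ^ 2 * (ρ * D) * (2 * ((4 + G) * A * u) ^ 2 + 8 * W ^ 2) ≤
      (2 * L ^ 2 * A ^ 4 * (4 + G) ^ 2 / ν ^ 2 + V' / 2) * u ^ 2 * (ν ^ 2 * D) := by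
    rw [hWsq]
    have hθ' : 16 * L ^ 2 * A ^ 2 * β * ρ ≤ ν ^ 2 / 2 := by
      have hν2 : 0 < ν ^ 2 := by positivity
      have h := hθ
      rw [div_mul_eq_mul_div, div_le_iff₀ hν2] at h
      linarith
    have e1 : L ^ 2 * A ^ 2 * (ρ * D) * (2 * ((4 + G) * A * u) ^ 2 + 8 * (2 * V' * (u ^ 2 * β))) =
        (2 * L ^ 2 * A ^ 4 * (4 + G) ^ 2 * ρ) * (u ^ 2 * D) +
          (16 * L ^ 2 * A ^ 2 * β * ρ) * V' * (u ^ 2 * D) := by ring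
    have e2 : (2 * L ^ 2 * A ^ 4 * (4 + G) ^ 2 / ν ^ 2 + V' / 2) * u ^ 2 * (ν ^ 2 * D) =
        (2 * L ^ 2 * A ^ 4 * (4 + G) ^ 2) * (u ^ 2 * D) + (ν ^ 2 / 2) * V' * (u ^ 2 * D) := by
      field_simp
    rw [e1, e2]
    have huD : 0 ≤ u ^ 2 * D := by positivity
    have t1 : (2 * L ^ 2 * A ^ 4 * (4 + G) ^ 2 * ρ) * (u ^ 2 * D) ≤
        (2 * L ^ 2 * A ^ 4 * (4 + G) ^ 2) * (u ^ 2 * D) := by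
      refine mul_le_mul_of_nonneg_right ?_ huD
      have h0 : 0 ≤ 2 * L ^ 2 * A ^ 4 * (4 + G) ^ 2 := by positivity
      nlinarith
    have t2 : (16 * L ^ 2 * A ^ 2 * β * ρ) * V' * (u ^ 2 * D) ≤ (ν ^ 2 / 2) * V' * (u ^ 2 * D) :=
      mul_le_mul_of_nonneg_right (mul_le_mul_of_nonneg_right hθ' hV) huD
    linarith
  exact hsq.trans (hmain.trans hfinal)

/-- **Constants bookkeeping, `rpow` form.** For `b ≥ 1`, `γ ∈ [1/2, 1]`, a shell `k`, source
bounds `p₀ = A b^{-γk}`, `p₋ = A b^{γ} b^{-γk}` and the upper-shell energy bound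
`Λ' = V'·b^{-2γ(k+1)}`, the forcing constant `c` of `forwardSourceSmoothing_shell_dissipative`
satisfies `c²/(ν² b^{4k}) ≤ (E₁ + V'/2)·b^{-2γk}` with `E₁ = 2L²A⁴(4 + b^{2γ})²/ν²`, provided
`16L²A²b^{-2γ}/ν² · b^{(1−2γ)k} ≤ ½`. [folklore] -/
theorem forwardSourceSmoothing_dissipative_constants {b L A ν γ V' : ℝ} {k : ℕ} (hb : 1 ≤ b)
    (hL : 0 ≤ L) (hA : 0 ≤ A) (hν : 0 < ν) (hγ : 1 / 2 ≤ γ) (hV : 0 ≤ V')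
    (hθ : 16 * L ^ 2 * A ^ 2 * b ^ (-(2 * γ)) / ν ^ 2 * b ^ ((1 - 2 * γ) * (k : ℝ)) ≤ 1 / 2) :
    (L * (4 * b ^ ((5 : ℝ) * (k : ℝ) / 2) * (A * b ^ (-(γ * (k : ℝ)))) ^ 2 +
        2 * b ^ ((5 : ℝ) * (k : ℝ) / 2) * (A * b ^ (-(γ * (k : ℝ)))) *
          Real.sqrt (2 * (V' * b ^ (-(2 * γ * ((k : ℝ) + 1))))) +
        b ^ ((5 : ℝ) * ((k : ℝ) - 1) / 2) * (A * b ^ γ * b ^ (-(γ * (k : ℝ)))) ^ 2)) ^ 2 /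
      (ν ^ 2 * b ^ ((4 : ℝ) * (k : ℝ))) ≤
      (2 * L ^ 2 * A ^ 4 * (4 + b ^ (2 * γ)) ^ 2 / ν ^ 2 + V' / 2) * b ^ (-(2 * γ * (k : ℝ))) := by
  have hb0 : 0 < b := by linarith
  have hk : (0 : ℝ) ≤ k := Nat.cast_nonneg k
  have hu2 : (b ^ (-(γ * (k : ℝ)))) ^ 2 = b ^ (-(2 * γ * (k : ℝ))) := by
    rw [sq, ← Real.rpow_add hb0]; ring_nf
  refine (forwardSourceSmoothing_constants_core (β := b ^ (-(2 * γ))) (G := b ^ (2 * γ))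
    (ρ := b ^ ((1 - 2 * γ) * (k : ℝ))) (D := b ^ ((4 : ℝ) * (k : ℝ))) hL hA hν
    (Real.rpow_nonneg hb0.le _) (Real.rpow_nonneg hb0.le _)
    (Real.rpow_le_rpow_of_exponent_le hb (by linarith)) (Real.rpow_nonneg hb0.le _)
    (Real.sqrt_nonneg _) hV ?_ ?_ (Real.rpow_nonneg hb0.le _)
    (Real.rpow_nonneg hb0.le _) (Real.rpow_le_one_of_one_le_of_nonpos hb (by nlinarith))
    (Real.rpow_pos_of_pos hb0 _) ?_ hθ).trans (le_of_eq (by rw [hu2]))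
  · -- `W² = 2V'u²β`
    rw [Real.sq_sqrt (by positivity), hu2, mul_assoc, ← Real.rpow_add hb0]
    ring_nf
  · -- `g² = G`
    rw [sq, ← Real.rpow_add hb0]; ring_nf
  · -- `P²u² = ρD`
    rw [hu2, sq, ← Real.rpow_add hb0, ← Real.rpow_add hb0, ← Real.rpow_add hb0]
    ring_nf

/-! ## The far shells -/

/-- **Non-source energies beyond the crossover inherit the source envelope.** Let `X` be a regular
solution of the `ν`-viscous lattice on `[0,s]` from a one-shell datum at shell `0` (continuous,
a priori weight `(1+ε₀)^{10k}`), with symmetric cancelling structure constants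
bounded by `M_α` on the shift set and a mode set `S` containing the forward sources; suppose the
sources obey `|X_{i,k}(t)| ≤ A(1+ε₀)^{-γk}` on `[0,s]` (`k ≥ 0`, `γ ∈ [1/2,1]`).  If `n₁ ≥ 1` is
beyond the crossover — for `k ≥ n₁` the linear rate is dominated
(`4m³M_α(1+ε₀)^{5k/2}A(1+ε₀)^{-γk} ≤ ν(1+ε₀)^{2k}/2`) and the catalysed exchange is contracting
(`16(m³M_α)²A²(1+ε₀)^{-2γ}/ν²·(1+ε₀)^{(1−2γ)k} ≤ ½`) — then for every `k ≥ n₁` and `t ∈ [0,s]`,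
`Σ_{d∉S} ½X_{d,k}(t)² ≤ 2E₁(1+ε₀)^{-2γk}`, `E₁ = 2(m³M_α)²A⁴(4+(1+ε₀)^{2γ})²/ν²` — a bound that does
not depend on the solution (iteration of `V_k ≤ E₁ + ½V_{k+1}` from the a priori weight).
[cite: BarbatoMorandinRomito2011, §3.2 (bootstrap); Tao2016AveragedNS, §4 (4.5), (4.8)] -/
theorem forwardSourceSmoothing_far_shells {ε₀ ν Mα A γ s : ℝ} {n₁ : ℕ} (hε₀ : 0 < ε₀) (hν : 0 < ν)
    (hMα : 0 ≤ Mα) (hA : 0 ≤ A) (hγ : 1 / 2 ≤ γ) (hγ1 : γ ≤ 1)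
    {α : Fin m → Fin m → Fin m → ℤ × ℤ × ℤ → ℝ} (hs : IsSymmetricCoeff α) (hc : IsCancellingCoeff α)
    (hα : ∀ i₁ i₂ i₃ μ, μ ∈ shiftSet → |α i₁ i₂ i₃ μ| ≤ Mα)
    (S : Finset (Fin m)) (hS : ∀ i, i ∉ S → ∀ j l : Fin m, α i j l (0, 0, 1) = 0)
    {X : Fin m → ℤ → ℝ → ℝ} (h0 : ∀ i (k : ℤ), k ≠ 0 → X i k 0 = 0)
    (hbdd : ∃ M : ℝ, ∀ (t : ℝ) (i : Fin m) (k : ℤ), (1 + (1 + ε₀) ^ ((10 : ℝ) * k)) * |X i k t| ≤ M)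
    (hcont : ∀ i k, Continuous (X i k))
    (hder : ∀ i k, ∀ t ∈ Icc (0 : ℝ) s, HasDerivWithinAt (X i k)
      (quadTerm ε₀ α X i k t - ν * (1 + ε₀) ^ ((2 : ℝ) * k) * X i k t) (Icc 0 s) t)
    (hSb : ∀ (k : ℕ), ∀ t ∈ Icc (0 : ℝ) s, ∀ i ∈ S, |X i k t| ≤ A * (1 + ε₀) ^ (-(γ * (k : ℝ))))
    (hn₁ : 1 ≤ n₁)
    (hdom : ∀ k : ℕ, n₁ ≤ k → 4 * ((m : ℝ) ^ 3 * Mα) * (1 + ε₀) ^ ((5 : ℝ) * (k : ℝ) / 2) *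
      (A * (1 + ε₀) ^ (-(γ * (k : ℝ)))) ≤ ν * (1 + ε₀) ^ ((2 : ℝ) * (k : ℝ)) / 2)
    (hθ : ∀ k : ℕ, n₁ ≤ k → 16 * ((m : ℝ) ^ 3 * Mα) ^ 2 * A ^ 2 * (1 + ε₀) ^ (-(2 * γ)) / ν ^ 2 *
      (1 + ε₀) ^ ((1 - 2 * γ) * (k : ℝ)) ≤ 1 / 2) :
    ∀ k : ℕ, n₁ ≤ k → ∀ t ∈ Icc (0 : ℝ) s, ∑ d ∈ Sᶜ, (1 / 2 : ℝ) * X d k t ^ 2 ≤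
      2 * (2 * ((m : ℝ) ^ 3 * Mα) ^ 2 * A ^ 4 * (4 + (1 + ε₀) ^ (2 * γ)) ^ 2 / ν ^ 2) *
        (1 + ε₀) ^ (-(2 * γ * (k : ℝ))) := by
  set b : ℝ := 1 + ε₀ with hb
  set L : ℝ := (m : ℝ) ^ 3 * Mα with hL
  set E₁ : ℝ := 2 * L ^ 2 * A ^ 4 * (4 + b ^ (2 * γ)) ^ 2 / ν ^ 2 with hE₁
  have hb1 : 1 ≤ b := by rw [hb]; linarith
  have hb0 : 0 < b := by linarith
  have hL0 : 0 ≤ L := by positivity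
  have hE₁0 : 0 ≤ E₁ := by positivity
  obtain ⟨M, hM⟩ := hbdd
  -- amplitudes from the a priori weight: `|X_{i,k}(t)| ≤ M b^{-10k}` (`k ≥ 0`)
  have hamp : ∀ (t : ℝ) (i : Fin m) (k : ℕ), |X i k t| ≤ M * b ^ (-((10 : ℝ) * (k : ℝ))) := by
    intro t i k
    have h := hM t i k
    have hw : 0 < b ^ ((10 : ℝ) * ((k : ℤ) : ℝ)) := Real.rpow_pos_of_pos hb0 _
    have h1 : b ^ ((10 : ℝ) * ((k : ℤ) : ℝ)) * |X i k t| ≤ M :=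
      le_trans (mul_le_mul_of_nonneg_right (by linarith) (abs_nonneg _)) h
    rw [show -((10 : ℝ) * (k : ℝ)) = -((10 : ℝ) * ((k : ℤ) : ℝ)) by push_cast; ring,
      Real.rpow_neg hb0.le, ← div_eq_mul_inv, le_div_iff₀ hw, mul_comm]
    exact h1
  set B₀ : ℝ := (m : ℝ) * M ^ 2 with hB₀
  have hB₀0 : 0 ≤ B₀ := by positivity
  -- nonnegativity of the energies
  have hy0 : ∀ (k : ℤ) τ, 0 ≤ ∑ d ∈ Sᶜ, (1 / 2 : ℝ) * X d k τ ^ 2 := fun k τ =>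
    Finset.sum_nonneg fun d _ => by positivity
  -- the iteration `V_k ≤ E₁ + V_{k+1}/2` from the a priori start `V_k ≤ B₀`
  have claim : ∀ j : ℕ, ∀ k : ℕ, n₁ ≤ k → ∀ t ∈ Icc (0 : ℝ) s,
      b ^ (2 * γ * (k : ℝ)) * ∑ d ∈ Sᶜ, (1 / 2 : ℝ) * X d k t ^ 2 ≤ 2 * E₁ + B₀ / 2 ^ j := by
    intro j
    induction j with
    | zero =>
      intro k _ t _
      -- a priori: `y_k ≤ (m/2) M² b^{-20k}` and `b^{2γk} b^{-20k} ≤ 1`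
      have h1 : ∑ d ∈ Sᶜ, (1 / 2 : ℝ) * X d k t ^ 2 ≤
          ∑ _d ∈ Sᶜ, (1 / 2 : ℝ) * (M * b ^ (-((10 : ℝ) * (k : ℝ)))) ^ 2 := by
        refine Finset.sum_le_sum fun d _ => mul_le_mul_of_nonneg_left ?_ (by norm_num)
        rw [← sq_abs (X d k t)]
        exact pow_le_pow_left₀ (abs_nonneg _) (hamp t d k) 2
      have hcard : ((Sᶜ : Finset (Fin m)).card : ℝ) ≤ m := by
        exact_mod_cast (card_le_univ _).trans_eq (by simp)
      have h2 : ∑ _d ∈ Sᶜ, (1 / 2 : ℝ) * (M * b ^ (-((10 : ℝ) * (k : ℝ)))) ^ 2 ≤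
          (m : ℝ) * ((1 / 2 : ℝ) * (M * b ^ (-((10 : ℝ) * (k : ℝ)))) ^ 2) := by
        rw [Finset.sum_const, nsmul_eq_mul]
        exact mul_le_mul_of_nonneg_right hcard (by positivity)
      have h3 : b ^ (2 * γ * (k : ℝ)) * ((m : ℝ) * ((1 / 2 : ℝ) * (M * b ^ (-((10 : ℝ) * (k : ℝ)))) ^ 2))
          = (1 / 2) * B₀ * b ^ ((2 * γ - 20) * (k : ℝ)) := by
        rw [hB₀, mul_pow, sq (b ^ _), ← Real.rpow_add hb0]
        have : b ^ (2 * γ * (k : ℝ)) * ((m : ℝ) * ((1 / 2 : ℝ) * (M ^ 2 *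
            b ^ (-((10 : ℝ) * (k : ℝ)) + -((10 : ℝ) * (k : ℝ)))))) =
            (1 / 2) * ((m : ℝ) * M ^ 2) * (b ^ (2 * γ * (k : ℝ)) *
              b ^ (-((10 : ℝ) * (k : ℝ)) + -((10 : ℝ) * (k : ℝ)))) := by ring
        rw [this, ← Real.rpow_add hb0]
        ring_nf
      have h4 : b ^ ((2 * γ - 20) * (k : ℝ)) ≤ 1 :=
        Real.rpow_le_one_of_one_le_of_nonpos hb1
          (mul_nonpos_of_nonpos_of_nonneg (by linarith) (Nat.cast_nonneg k))
      have h5 : b ^ (2 * γ * (k : ℝ)) * ∑ d ∈ Sᶜ, (1 / 2 : ℝ) * X d k t ^ 2 ≤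
          (1 / 2) * B₀ * b ^ ((2 * γ - 20) * (k : ℝ)) := by
        rw [← h3]
        exact mul_le_mul_of_nonneg_left (h1.trans h2) (Real.rpow_nonneg hb0.le _)
      have h6 : (1 / 2) * B₀ * b ^ ((2 * γ - 20) * (k : ℝ)) ≤ B₀ := by
        have := mul_le_mul_of_nonneg_left h4 hB₀0
        linarith
      simp only [pow_zero, div_one]
      linarith
    | succ j ih =>
      intro k hk t ht
      have hk1 : 1 ≤ k := hn₁.trans hk
      -- the bound on shell `k+1`
      set V' : ℝ := 2 * E₁ + B₀ / 2 ^ j with hV'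
      have hV'0 : 0 ≤ V' := by positivity
      set Λ' : ℝ := V' * b ^ (-(2 * γ * ((k : ℝ) + 1))) with hΛ'
      have hup : ∀ τ ∈ Icc (0 : ℝ) s, ∑ d ∈ Sᶜ, (1 / 2 : ℝ) * X d ((k : ℤ) + 1) τ ^ 2 ≤ Λ' := by
        intro τ hτ
        have h := ih (k + 1) (by omega) τ hτ
        have hpos : 0 < b ^ (2 * γ * (((k + 1 : ℕ) : ℝ))) := Real.rpow_pos_of_pos hb0 _
        rw [mul_comm, ← le_div_iff₀ hpos] at h
        have hcast : (((k + 1 : ℕ) : ℤ)) = (k : ℤ) + 1 := by push_cast; ring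
        rw [hcast] at h
        refine h.trans (le_of_eq ?_)
        rw [hΛ', div_eq_mul_inv, ← Real.rpow_neg hb0.le]
        push_cast
        ring_nf
      -- source bounds on the three shells
      have hS0 : ∀ τ ∈ Icc (0 : ℝ) s, ∀ i ∈ S, |X i (k : ℤ) τ| ≤ A * b ^ (-(γ * (k : ℝ))) :=
        fun τ hτ i hi => hSb k τ hτ i hi
      have hS1 : ∀ τ ∈ Icc (0 : ℝ) s, ∀ i ∈ S,
          |X i ((k : ℤ) + 1) τ| ≤ A * b ^ (-(γ * ((k : ℝ) + 1))) := by
        intro τ hτ i hi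
        have h := hSb (k + 1) τ hτ i hi
        have hcast : (((k + 1 : ℕ) : ℤ)) = (k : ℤ) + 1 := by push_cast; ring
        rw [hcast] at h
        simpa using h
      have hSm : ∀ τ ∈ Icc (0 : ℝ) s, ∀ i ∈ S,
          |X i ((k : ℤ) - 1) τ| ≤ A * b ^ γ * b ^ (-(γ * (k : ℝ))) := by
        intro τ hτ i hi
        have h := hSb (k - 1) τ hτ i hi
        have hcast : (((k - 1 : ℕ) : ℤ)) = (k : ℤ) - 1 := by omega
        rw [hcast] at h
        refine h.trans (le_of_eq ?_)
        rw [mul_assoc, ← Real.rpow_add hb0, Nat.cast_sub hk1]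
        push_cast
        ring_nf
      have h10 : A * b ^ (-(γ * ((k : ℝ) + 1))) ≤ A * b ^ (-(γ * (k : ℝ))) :=
        mul_le_mul_of_nonneg_left (Real.rpow_le_rpow_of_exponent_le hb1 (by nlinarith)) hA
      have hdomk : 4 * ((m : ℝ) ^ 3 * Mα) * (1 + ε₀) ^ ((5 : ℝ) * ((k : ℤ) : ℝ) / 2) *
          (A * b ^ (-(γ * (k : ℝ)))) ≤ ν * (1 + ε₀) ^ ((2 : ℝ) * ((k : ℤ) : ℝ)) / 2 := by
        have := hdom k hk; push_cast; exact this
      -- the dissipative per-shell bound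
      have hshell := forwardSourceSmoothing_shell_dissipative (k := (k : ℤ)) (by linarith) hMα hs
        hc hα S hS hν hcont hder (by positivity) (by positivity) (by positivity) h10 hS0 hS1 hSm
        hup hdomk t ht
      -- `y_k(0) = 0`
      have hinit0 : ∑ d ∈ Sᶜ, (1 / 2 : ℝ) * X d (k : ℤ) 0 ^ 2 = 0 :=
        Finset.sum_eq_zero fun d _ => by rw [h0 d k (by omega)]; ring
      rw [hinit0, zero_add] at hshell
      push_cast at hshell
      -- constants bookkeeping
      have hconst := forwardSourceSmoothing_dissipative_constants (k := k) hb1 hL0 hA hν hγ hV'0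
        (hθ k hk)
      have hfin := hshell.trans hconst
      -- multiply by `b^{2γk}`
      have hpow : b ^ (2 * γ * (k : ℝ)) * b ^ (-(2 * γ * (k : ℝ))) = 1 := by
        rw [← Real.rpow_add hb0, add_neg_cancel, Real.rpow_zero]
      calc b ^ (2 * γ * (k : ℝ)) * ∑ d ∈ Sᶜ, (1 / 2 : ℝ) * X d k t ^ 2
          ≤ b ^ (2 * γ * (k : ℝ)) * ((E₁ + V' / 2) * b ^ (-(2 * γ * (k : ℝ)))) :=
            mul_le_mul_of_nonneg_left hfin (Real.rpow_nonneg hb0.le _)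
        _ = E₁ + V' / 2 := by
            rw [show b ^ (2 * γ * (k : ℝ)) * ((E₁ + V' / 2) * b ^ (-(2 * γ * (k : ℝ)))) =
              (E₁ + V' / 2) * (b ^ (2 * γ * (k : ℝ)) * b ^ (-(2 * γ * (k : ℝ)))) by ring, hpow,
              mul_one]
        _ = 2 * E₁ + B₀ / 2 ^ (j + 1) := by rw [hV', pow_succ]; ring
  -- let the number of iterations tend to infinity
  intro k hk t ht
  have hpos : 0 < b ^ (2 * γ * (k : ℝ)) := Real.rpow_pos_of_pos hb0 _
  have hle : b ^ (2 * γ * (k : ℝ)) * ∑ d ∈ Sᶜ, (1 / 2 : ℝ) * X d k t ^ 2 ≤ 2 * E₁ := by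
    refine le_of_forall_pos_le_add fun δ hδ => ?_
    obtain ⟨j, hj⟩ := exists_nat_gt (B₀ / δ)
    have h2j : (j : ℝ) + 1 ≤ (2 : ℝ) ^ j := by exact_mod_cast Nat.lt_two_pow_self
    have hj' : B₀ / 2 ^ j ≤ δ := by
      rw [div_le_iff₀ (by positivity)]
      rw [div_lt_iff₀ hδ] at hj
      nlinarith
    linarith [claim j k hk t ht]
  rw [mul_comm, ← le_div_iff₀ hpos] at hle
  refine hle.trans (le_of_eq ?_)
  rw [div_eq_mul_inv, ← Real.rpow_neg hb0.le]

end Summit.NavierStokesRegularity.NavierStokesRegularity.Theorems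

end
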